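import Mathlib
import Summits.Ventures.PercRepro2.HCov
import Summits.Ventures.PercRepro2.EdgeCubic
import Summits.Ventures.PercRepro2.EdgeCubicAll
import Summits.Ventures.PercRepro2.CPolarA3
import Summits.Ventures.PercRepro2.CPolarA3Marks
import Summits.Ventures.PercRepro2.CCTRootEdge
import Summits.Ventures.PercRepro2.PendantA3Pins
import Summits.Ventures.PercRepro2.PendantClusterPins
import Summits.Ventures.PercRepro2.PendantClusterMasses
import Summits.Ventures.PercRepro2.ReachRootEdge
import Summits.Ventures.PercRepro2.CPolarSub
import Summits.Ventures.PercRepro2.CPolarSubPlus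
import Summits.Ventures.PercRepro2.HCovPlusQuartic
import Summits.Ventures.PercRepro2.QuarticRoadBase

/-!
# THE ROAD ON THE QUARTIC, PART II — a pendant edge into a root's reach is free for (HCOV⁺)
(blind cell PercRepro2, p5 g17; `proofs/P5-OEDGE.md` §23)

Let `f = {z, u}` be the single fractional edge touching the mark-free reach `K` of `a₃` and let `u`
lie in the pinned-open reach of a root (the case `P(PD_u) = 0` of the pendant face, which
`QuarticPendant.hcovPlus_of_pendant` excludes). At the open pin `a₃` is joined to that root almost
surely, so `Gc₁ = covU₁ = slackB₁ = 0` (**`slackB_eq_zero_of_joined`**); the masses `Q`, `Qo`,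
`Qb`, `gap` are free of the pin (the marks lie outside `K`), the closed pin has `a₃` inactive
(`PendantCluster.pins_zero_cluster`), and the two cross terms of the quartic VANISH:
**`covUm = 0`** and **`slackBm = 0`**. Hence `H1 = Q·(B1 + Gc₀)`, `H2 = Q·(B1 + B2)`,
`H3 = Q·B2` with `B1, B2 ≥ 0` the cubic's reach-root theorem (`ReachRoot.bern_nonneg_of_isReachRootEdge`)
and **`HCovPlus_of_pendant_rootReach`**: (HCOV) ∧ (HCOV⁺) at the closed pin give (HCOV⁺) at `p`.
With this the joint induction of `QuarticRoad.lean` asks its hypothesis on exactly the domain of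
`InternalEdge.CPolarA3SubB2_all` (no internal edge, no pendant edge at all).
-/

namespace Summit.Ventures.PercRepro2

open UnionCluster CovForm CovForm.CPolarA3 CovForm.EdgeLine CCT PendantA3 PendantCluster ReachRoot
  CPolarSub CPolarSubPlus HCovPlusQuartic QuarticRoadBase

namespace QuarticRoadPendantRoot

section Joined

variable {V : Type*} {E : Type*} [Fintype E] [DecidableEq E] {R : Type*} [Field R]
  [LinearOrder R] [IsStrictOrderedRing R]

variable {q : E → R} {ends : E → Sym2 V}

omit [LinearOrder R] [IsStrictOrderedRing R] in
/-- `T(s, t, a₃) ∩ X` is null when `a₃` is almost surely joined to `s` (`a₃ ∈ C_t` would give `s ∈ C_t`). -/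
lemma prob_T_inter_eq_zero_of_joined {s t a₃ : V} (hj : ∀ ω, weight q ω ≠ 0 → Conn ends ω a₃ s)
    (X : Set (Config E)) : prob q (TEvent ends s t a₃ ∩ X) = 0 := by
  refine prob_eq_zero_of_weight_eq_zero q _ fun ω hω => ?_
  by_contra hw
  have hT := hω.1
  simp only [TEvent, Set.mem_inter_iff, Set.mem_compl_iff, mem_connEvent] at hT
  exact hT.1 (conn_trans hT.2 (hj ω hw))

omit [LinearOrder R] [IsStrictOrderedRing R] in
/-- `T(t, s, a₃) ∩ X = {s ↮ t} ∩ X` almost surely when `a₃` is almost surely joined to `s`. -/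
lemma prob_T'_inter_eq_of_joined {s t a₃ : V} (hj : ∀ ω, weight q ω ≠ 0 → Conn ends ω a₃ s)
    (X : Set (Config E)) :
    prob q (TEvent ends t s a₃ ∩ X) = prob q (avoidAll ends t {s} ∩ X) := by
  refine prob_congr_of_weight q _ _ fun ω hw => ?_
  simp only [TEvent, Set.mem_inter_iff, Set.mem_compl_iff, mem_connEvent, mem_avoidAll,
    Finset.mem_singleton, forall_eq]
  constructor
  · rintro ⟨⟨h, _⟩, hX⟩; exact ⟨fun hc => h (conn_symm hc), hX⟩
  · rintro ⟨h, hX⟩; exact ⟨⟨fun hc => h (conn_symm hc), conn_symm (hj ω hw)⟩, hX⟩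

/-- **`slackB = 0` when `a₃` is almost surely joined to `a₁`** (`σ₃ ≡ 1` on `Q`). -/
lemma slackB_eq_zero_of_joined_left {a₁ a₂ a₃ b : V}
    (hj : ∀ ω, weight q ω ≠ 0 → Conn ends ω a₃ a₁) : slackB q ends a₁ a₂ a₃ b = 0 := by
  have hjr : ∀ ω, weight q ω ≠ 0 → Conn ends ω a₃ a₁ ∨ Conn ends ω a₃ a₂ :=
    fun ω hw => Or.inl (hj ω hw)
  have hD : prob q (PDEvent ends a₁ a₂ a₃) = 0 := by
    have := prob_PD_inter_eq_zero_of_root hjr Set.univ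
    simpa only [Set.inter_univ] using this
  have hT : prob q (TEvent ends a₁ a₂ a₃) = 0 := by
    have := prob_T_inter_eq_zero_of_joined (t := a₂) hj Set.univ
    simpa only [Set.inter_univ] using this
  have hT' : prob q (TEvent ends a₂ a₁ a₃) = prob q (avoidAll ends a₂ {a₁}) := by
    have := prob_T'_inter_eq_of_joined (t := a₂) hj Set.univ
    simpa only [Set.inter_univ] using this
  rw [slackB_eq]
  unfold EQb3 EQ3 PDb
  rw [gap_eq_Q]
  simp only [prob_T_inter_eq_zero_of_joined (t := a₂) hj, prob_T'_inter_eq_of_joined (t := a₂) hj,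
    hD, hT, hT', prob_PD_inter_eq_zero_of_root hjr]
  ring

/-- **`slackB = 0` when `a₃` is almost surely joined to `a₂`** (`σ₃ ≡ −1` on `Q`). -/
lemma slackB_eq_zero_of_joined_right {a₁ a₂ a₃ b : V}
    (hj : ∀ ω, weight q ω ≠ 0 → Conn ends ω a₃ a₂) : slackB q ends a₁ a₂ a₃ b = 0 := by
  have hjr : ∀ ω, weight q ω ≠ 0 → Conn ends ω a₃ a₁ ∨ Conn ends ω a₃ a₂ :=
    fun ω hw => Or.inr (hj ω hw)
  have hD : prob q (PDEvent ends a₁ a₂ a₃) = 0 := by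
    have := prob_PD_inter_eq_zero_of_root hjr Set.univ
    simpa only [Set.inter_univ] using this
  have hT : prob q (TEvent ends a₂ a₁ a₃) = 0 := by
    have := prob_T_inter_eq_zero_of_joined (t := a₁) hj Set.univ
    simpa only [Set.inter_univ] using this
  have hT' : ∀ X, prob q (TEvent ends a₁ a₂ a₃ ∩ X) = prob q (avoidAll ends a₂ {a₁} ∩ X) := by
    intro X
    have := prob_T'_inter_eq_of_joined (t := a₁) hj X
    refine this.trans (prob_congr_of_weight q _ _ fun ω _ => ?_)
    simp only [Set.mem_inter_iff, mem_avoidAll, Finset.mem_singleton, forall_eq]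
    exact and_congr_left fun _ => not_congr ⟨conn_symm, conn_symm⟩
  have hT'u : prob q (TEvent ends a₁ a₂ a₃) = prob q (avoidAll ends a₂ {a₁}) := by
    have := hT' Set.univ
    simpa only [Set.inter_univ] using this
  rw [slackB_eq]
  unfold EQb3 EQ3 PDb
  rw [gap_eq_Q]
  simp only [prob_T_inter_eq_zero_of_joined (t := a₁) hj, hT', hD, hT, hT'u,
    prob_PD_inter_eq_zero_of_root hjr]
  ring

end Joined

section Pendant

variable {V : Type*} {E : Type*} [Fintype V] [DecidableEq V] [Fintype E] [DecidableEq E]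
  {R : Type*} [Field R] [LinearOrder R] [IsStrictOrderedRing R]

variable {p : E → R} {ends : E → Sym2 V} {f : E} {a₃ z u : V}

omit [Fintype V] [DecidableEq V] [LinearOrder R] [IsStrictOrderedRing R] in
/-- The mass of a free event is unchanged by the open pin. -/
lemma prob_update_one_of_freeAE {X : Set (Config E)} (hX : FreeAE p f X) :
    prob (Function.update p f 1) X = prob p X := by
  rw [prob_update_one_eq]
  exact prob_congr_of_weight p _ _ fun ω hw => hX ω hw true

omit [Fintype V] [DecidableEq V] [IsStrictOrderedRing R] in
/-- With `f` open and `u` in the reach of `r`, `a₃ ↔ r` on every configuration of positive weight. -/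
lemma conn_a3_root_of_update_one (hf : ends f = s(z, u)) (hz : z ∈ pinnedReach p ends a₃)
    (hf1 : p f ≠ 1) {r : V} (hur : u ∈ pinnedReach p ends r) {ω : Config E}
    (hw : weight (Function.update p f 1) ω ≠ 0) : Conn ends ω a₃ r := by
  have hle : pinnedConfig p ≤ ω := by
    intro e'
    by_cases h1 : p e' = 1
    · have hne : e' ≠ f := fun h => hf1 (h ▸ h1)
      have : Function.update p f 1 e' = 1 := by rw [Function.update_of_ne hne]; exact h1
      rw [open_of_weight_ne_zero hw this]; exact Bool.le_true _
    · have h0 : pinnedConfig p e' = false := by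
        unfold pinnedConfig; rw [decide_eq_false_iff_not]; exact h1
      rw [h0]; exact Bool.false_le _
  have hfo : ω f = true := open_of_weight_ne_zero hw (by simp)
  have h3z : Conn ends ω a₃ z := conn_mono hle hz
  have hzu : Conn ends ω z u := conn_of_openAdj ⟨f, hfo, hf⟩
  have hur' : Conn ends ω r u := conn_mono hle hur
  exact conn_trans (conn_trans h3z hzu) (conn_symm hur')

variable (hK : ∀ e ∈ fracEdges p, TouchesReach p ends a₃ e → e = f) (hf : ends f = s(z, u))
  (hz : z ∈ pinnedReach p ends a₃) (hu : u ∉ pinnedReach p ends a₃) (hf1 : p f ≠ 1)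

include hK hf hz hu hf1

/-- **A pendant edge into a root's reach is free for (HCOV⁺)**: (HCOV) ∧ (HCOV⁺) at the closed pin
give (HCOV⁺) at `p` (the cross terms `covUm`, `slackBm` vanish; `H1 = Q(B1 + Gc₀)`, `H2 = Q(B1 + B2)`,
`H3 = Q·B2`). -/
theorem HCovPlus_of_pendant_rootReach (hp : IsProbVec p) {o a₁ a₂ b : V}
    (h1 : a₁ ∉ pinnedReach p ends a₃) (h2 : a₂ ∉ pinnedReach p ends a₃)
    (ho : o ∉ pinnedReach p ends a₃) (hb : b ∉ pinnedReach p ends a₃)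
    (hur : u ∈ pinnedReach p ends a₁ ∨ u ∈ pinnedReach p ends a₂)
    (h₀ : HCov (Function.update p f 0) ends o a₁ a₂ a₃ b)
    (h₀p : HCovPlus (Function.update p f 0) ends o a₁ a₂ a₃ b) :
    HCovPlus p ends o a₁ a₂ a₃ b := by
  -- the open pin: `a₃` joined to a root almost surely
  have hj : ∀ ω, weight (Function.update p f 1) ω ≠ 0 →
      Conn ends ω a₃ a₁ ∨ Conn ends ω a₃ a₂ := fun ω hw =>
    hur.elim (fun h => Or.inl (conn_a3_root_of_update_one hf hz hf1 h hw))
      (fun h => Or.inr (conn_a3_root_of_update_one hf hz hf1 h hw))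
  have h₁p : HCovPlus (Function.update p f 1) ends o a₁ a₂ a₃ b := HCovPlus_of_root_joined hj
  have hGc1 : Gc (Function.update p f 1) ends o a₁ a₂ a₃ b = 0 := Gc_eq_zero_of_root o b hj
  have hcov1 : covU (Function.update p f 1) ends o a₁ a₂ a₃ = 0 := covU_eq_zero_of_root hj
  have hD1 : prob (Function.update p f 1) (PDEvent ends a₁ a₂ a₃) = 0 := by
    have := prob_PD_inter_eq_zero_of_root hj Set.univ
    simpa only [Set.inter_univ] using this
  have hDo1 : Do (Function.update p f 1) ends o a₁ a₂ a₃ = 0 := by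
    unfold Do; simp only [prob_PD_inter_eq_zero_of_root hj]; ring
  have hPDb1 : PDb (Function.update p f 1) ends a₁ a₂ a₃ b = 0 := by
    unfold PDb; simp only [prob_PD_inter_eq_zero_of_root hj]; ring
  have hsl1 : slackB (Function.update p f 1) ends a₁ a₂ a₃ b = 0 := by
    rcases hur with h | h
    · exact slackB_eq_zero_of_joined_left fun ω hw => conn_a3_root_of_update_one hf hz hf1 h hw
    · exact slackB_eq_zero_of_joined_right fun ω hw => conn_a3_root_of_update_one hf hz hf1 h hw
  -- the closed pin: `a₃` inactive
  obtain ⟨hQ0, hD0, hDo0, -, hEQb3_0, -, -, hEQ3_0, -, hPDb0, -, hgap0⟩ :=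
    pins_zero_cluster p hK hf hz hu hf1 h1 h2 ho hb
  -- the masses free of the pin
  have hQ1 : prob (Function.update p f 1) (avoidAll ends a₂ {a₁}) = prob p (avoidAll ends a₂ {a₁}) :=
    prob_update_one_of_freeAE (freeAE_Q hK hf hz hu hf1 h1 h2)
  have hQo1 : Qo (Function.update p f 1) ends o a₁ a₂ = Qo p ends o a₁ a₂ := by
    unfold Qo
    rw [prob_update_one_of_freeAE ((freeAE_Q hK hf hz hu hf1 h1 h2).inter
      (freeAE_connEvent hK hf hz hu hf1 h1 ho)),
      prob_update_one_of_freeAE ((freeAE_Q hK hf hz hu hf1 h1 h2).inter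
      (freeAE_connEvent hK hf hz hu hf1 h2 ho))]
  have hQo0 : Qo (Function.update p f 0) ends o a₁ a₂ = Qo p ends o a₁ a₂ := by
    unfold Qo
    rw [pz_Q_c hK hf hz hu hf1 h2 h1 h1 ho, pz_Q_c hK hf hz hu hf1 h2 h1 h2 ho]
  have hQb1 : Qb (Function.update p f 1) ends a₁ a₂ b = Qb p ends a₁ a₂ b := by
    unfold Qb
    rw [prob_update_one_of_freeAE ((freeAE_Q hK hf hz hu hf1 h1 h2).inter
      (freeAE_connEvent hK hf hz hu hf1 h1 hb)),
      prob_update_one_of_freeAE ((freeAE_Q hK hf hz hu hf1 h1 h2).inter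
      (freeAE_connEvent hK hf hz hu hf1 h2 hb))]
  have hQb0 : Qb (Function.update p f 0) ends a₁ a₂ b = Qb p ends a₁ a₂ b := by
    unfold Qb
    rw [pz_Q_c hK hf hz hu hf1 h2 h1 h1 hb, pz_Q_c hK hf hz hu hf1 h2 h1 h2 hb]
  have hgap1 : gap (Function.update p f 1) ends a₁ a₂ b = gap p ends a₁ a₂ b := by
    unfold gap
    rw [prob_update_one_of_freeAE (freeAE_connEvent hK hf hz hu hf1 h2 hb),
      prob_update_one_of_freeAE (freeAE_connEvent hK hf hz hu hf1 h1 hb)]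
  -- the open pin's `EQb3`, `EQ3` and the `gap` identity
  have hgapQ : gap p ends a₁ a₂ b =
      prob p (avoidAll ends a₂ {a₁} ∩ connEvent ends a₂ b) -
        prob p (avoidAll ends a₂ {a₁} ∩ connEvent ends a₁ b) := gap_eq_Q p ends a₁ a₂ b
  have hQbsum : Qb p ends a₁ a₂ b = prob p (avoidAll ends a₂ {a₁} ∩ connEvent ends a₁ b) +
      prob p (avoidAll ends a₂ {a₁} ∩ connEvent ends a₂ b) := rfl
  have hQosum : Qo p ends o a₁ a₂ = prob p (avoidAll ends a₂ {a₁} ∩ connEvent ends a₁ o) +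
      prob p (avoidAll ends a₂ {a₁} ∩ connEvent ends a₂ o) := rfl
  -- the cross terms vanish
  have hcovUm : covUm p ends o a₁ a₂ a₃ f = 0 := by
    unfold covUm
    rw [hQo1, hQo0, hD0, hD1, hQ1, hDo0, hQ0, hDo1, hQosum]
    ring
  have hslm : slackBm p ends a₁ a₂ a₃ b f = 0 := by
    unfold slackBm
    rw [hEQb3_0, hEQ3_0, hPDb1, hD1, hPDb0, hD0, hQb0, hQb1, hQ1, hQ0, hgap1, hgap0]
    rcases hur with h | h
    · have hj' : ∀ ω, weight (Function.update p f 1) ω ≠ 0 → Conn ends ω a₃ a₁ :=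
        fun ω hw => conn_a3_root_of_update_one hf hz hf1 h hw
      have hT : prob (Function.update p f 1) (TEvent ends a₁ a₂ a₃) = 0 := by
        have := prob_T_inter_eq_zero_of_joined (t := a₂) hj' Set.univ
        simpa only [Set.inter_univ] using this
      have hT' : prob (Function.update p f 1) (TEvent ends a₂ a₁ a₃) =
          prob (Function.update p f 1) (avoidAll ends a₂ {a₁}) := by
        have := prob_T'_inter_eq_of_joined (t := a₂) hj' Set.univ
        simpa only [Set.inter_univ] using this
      unfold EQb3 EQ3
      simp only [prob_T_inter_eq_zero_of_joined (t := a₂) hj', prob_T'_inter_eq_of_joined (t := a₂) hj',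
        hT, hT', hQ1]
      rw [prob_update_one_of_freeAE ((freeAE_Q hK hf hz hu hf1 h1 h2).inter
        (freeAE_connEvent hK hf hz hu hf1 h1 hb)),
        prob_update_one_of_freeAE ((freeAE_Q hK hf hz hu hf1 h1 h2).inter
        (freeAE_connEvent hK hf hz hu hf1 h2 hb)), hgapQ, hQbsum]
      ring
    · have hj' : ∀ ω, weight (Function.update p f 1) ω ≠ 0 → Conn ends ω a₃ a₂ :=
        fun ω hw => conn_a3_root_of_update_one hf hz hf1 h hw
      have hT : prob (Function.update p f 1) (TEvent ends a₂ a₁ a₃) = 0 := by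
        have := prob_T_inter_eq_zero_of_joined (t := a₁) hj' Set.univ
        simpa only [Set.inter_univ] using this
      have hT' : ∀ X, prob (Function.update p f 1) (TEvent ends a₁ a₂ a₃ ∩ X) =
          prob (Function.update p f 1) (avoidAll ends a₂ {a₁} ∩ X) := by
        intro X
        refine (prob_T'_inter_eq_of_joined (t := a₁) hj' X).trans
          (prob_congr_of_weight _ _ _ fun ω _ => ?_)
        simp only [Set.mem_inter_iff, mem_avoidAll, Finset.mem_singleton, forall_eq]
        exact and_congr_left fun _ => not_congr ⟨conn_symm, conn_symm⟩
      have hT'u : prob (Function.update p f 1) (TEvent ends a₁ a₂ a₃) =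
          prob (Function.update p f 1) (avoidAll ends a₂ {a₁}) := by
        have := hT' Set.univ
        simpa only [Set.inter_univ] using this
      unfold EQb3 EQ3
      simp only [prob_T_inter_eq_zero_of_joined (t := a₁) hj', hT', hT, hT'u, hQ1]
      rw [prob_update_one_of_freeAE ((freeAE_Q hK hf hz hu hf1 h1 h2).inter
        (freeAE_connEvent hK hf hz hu hf1 h1 hb)),
        prob_update_one_of_freeAE ((freeAE_Q hK hf hz hu hf1 h1 h2).inter
        (freeAE_connEvent hK hf hz hu hf1 h2 hb)), hgapQ, hQbsum]
      ring
  -- the cubic's reach-root theorem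
  obtain ⟨hB1, hB2⟩ := bern_nonneg_of_isReachRootEdge p hp ends o a₁ a₂ a₃ b f
    ⟨z, hz, u, hur, Or.inr hf⟩ hf1 h₀
  have hQnn : 0 ≤ prob p (avoidAll ends a₂ {a₁}) := prob_nonneg hp _
  have hGc0 : 0 ≤ Gc (Function.update p f 0) ends o a₁ a₂ a₃ b := h₀
  refine HCovPlus_of_update_zero_of_bern p hp ends o a₁ a₂ a₃ b f h₀p h₁p ?_ ?_ ?_
  · unfold H1
    rw [hcovUm, hslm, hQ0, hQ1]
    have := mul_nonneg hQnn (add_nonneg hB1 hGc0)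
    linarith [this]
  · unfold H2
    rw [hcovUm, hslm, hsl1, hcov1, hQ0, hQ1]
    have := mul_nonneg hQnn (add_nonneg hB2 hB1)
    linarith [this]
  · unfold H3
    rw [hGc1, hcovUm, hcov1, hQ1]
    have := mul_nonneg hQnn hB2
    linarith [this]

end Pendant

end QuarticRoadPendantRoot

end Summit.Ventures.PercRepro2
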